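import Summits.BirchSwinnertonDyer.BirchSwinnertonDyer.Theses.UniversalToricDescent
import Summits.BirchSwinnertonDyer.BirchSwinnertonDyer.Theorems.UniversalToricDescentTwinAlgMuZeroAtThreeOfBetaRoadParam
import Summits.BirchSwinnertonDyer.BirchSwinnertonDyer.Theorems.UniversalToricDescentTwinAlgMuZeroAtThreeOfBuckets
import HarnessLib

/-!
# Crux 24737 `TwinAlgMuZeroAtThree` — NODE `self_dual_flach` (crux-ideate g5, idea `self-dual-flach-system`)

D-0171 node for `stmt-BirchSwinnertonDyer-24737` (NOT registered; the registered skeleton of record stays `Lines/beta_road.lean` v19,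
sha16 `4b5d40f4a458397e`).  Companion cards: `Ideas/self-dual-flach-system.md` (crux idea), `Lines/self_dual_flach.md` (node card).

THESIS OF THE LINE (bucket B = multiplicative très ramifié twins, `3 ∥ N′`, `a₃ = ±1`, hence `3`-ORDINARY).  Under the Heegner hypothesis
every anticyclotomic twist `L(f_{E′}/K, χ, s)` has sign `−1`, so the `f`-dominant Hida–Rankin `p`-adic `L`-function of the pair
(`f_{E′}`, CM family of `K`) VANISHES IDENTICALLY on the anticyclotomic line; by the weight-(2,1) reciprocity law the anticyclotomic
Beilinson–Flach classes of the twin are therefore ORDINARY AT BOTH primes above `3`, i.e. they live in Howard's SELF-DUAL Greenberg structure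
`Sel_{Gr,Gr}` (no Mazur–Rubin (H.4) issue at `p = 3`) and form a Heegner-TYPE `Λ`-adic system `{BF_m}` over the ring-class towers.  For THIS
system the local indivisibility «(β)» of the bottom class is a THEOREM SHAPE, not a certificate: the `g`-dominant explicit reciprocity law read
at `𝔭′` gives `Col_{𝔭′}(loc_{𝔭′} BF^{ac}) = u · L_𝔭^{BDP}(E′/K) · L_𝔭^{BDP}(E′/K)^ι · (Katz unit)`, an identity in the Hida family of TAME
level `M = N′/3` in which the `3`-new point of `f_{E′}` is an interior classical point (KLZ17 Thm. 6.3.4 allows `p ≥ 3`, `p ∣ N`), and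
`μ = 0` of the right-hand side is the route's OWN analytic input `TwinMuZeroAtThree` (item 20400) + Hida's `μ(Katz) = 0`.  Howard's machine
(the SAME machine as K2a‴, run on `{BF_m}`) and Castella's bookkeeping `length_P(X_(∅,0)) = length_P(X_tors) + 2·length_P(coker loc)`
(BCK21 eq. (A3)) then give `char X_(∅,0)(E′/K_∞) ∣ Col_{𝔭′}(loc BF^{ac})²` — torsion and `μ = 0` for bucket B with NO Heegner point, NO
instance computation and NO K1‴.  Bucket C₀ is the registered constant C₀′ BY NAME (this line says nothing there: `a₃ = 0` is non-ordinary).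

PIECES (D-0171 tags; evidence and leaves in `Lines/self_dual_flach.md`):
* S_B `FlachHowardShapeMultOfParamAtThree` / `stub_flachMult` — bucket B in HOWARD SHAPE («torsion ∧ one frame `L` inside `Ch·R₀⟦T⟧` with a
  norm-one coefficient»; the route's `…TwinAlgMu.xac_exists_generator_norm_one_of_span_le` sanctions Howard-shape bucket stubs).  UNDECIDED ·
  EQUIV to the bucket-B half of the crux (receptacle both ways) — its content is the informal decomposition S1–S4 of the card, NOT typable
  today: the tree has no Beilinson–Flach / Rankin–Eisenstein class, no Hida `g`-dominant Rankin–Selberg measure (`lean search` 0 hits) —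
  definition requests D1–D3 in the card.  Evidence `flachShape_of_betaRoad` (below, no `sorry`): K1‴ ∧ K2a‴ ⟹ S_B, so S_B is WEAKER-OR-EQUAL
  than the line of record's bucket-B pair; the intended frame is `L = Col_{𝔭′}(loc BF^{ac})²`.
  Children (markdown): S1 «anticyclotomic BF system at `3 ∥ N′` inside `Sel_{Gr,Gr}`, bottom class `≠ 0`» IDEA-NEEDED→ATTACKABLE (KLZ17
  Thm. 6.3.4 `p ≥ 3`; LLZ15 inert-`c` patch PROVED in g52's sketch; membership by sign + weight-(2,1) reciprocity by continuity at the 3-new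
  point) · S2 «Howard/CGLS ES→KS for `{BF_m}` on the self-dual `Λ`-adic source setting» UNDECIDED (= K2a‴'s machine: audit Δ1–Δ3 of
  `AuditKSHypothesesAtThree-g53.md` apply verbatim) · S3 «`g`-dominant ERL at the 3-new point» ATTACKABLE (continuity in the tame-level-`M`
  Hida family; no adjoint period of `f` on the `g`-dominant side) · S4 «(A3) bookkeeping + Howard output ⟹ `char X_(∅,0) ∣ Col(loc BF)²`»
  WEAKER · ATTACKABLE (pure `Λ`-algebra given rank one; BCK21 Thm. 4.1 / Castella JLMS17 App. A).
* C₀′ `stub_goodSS` — the registered constant BY NAME · UNDECIDED (untouched by this line).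
* `TwinAlgMuZeroAtThree_of` — the crux BY NAME from S_B and C₀′ (kernel-checked; bucket split + receptacle).

HONEST FRAMING: nothing is discharged; two `sorry`s (the two stubs) and nowhere else; crux 24737 stays OPEN; BSD is proved for no curve here.
References: [KLZ17] = arXiv:1503.02888 Thm. 6.3.4, Thm. B; [LLZ15] = arXiv:1311.0175 §7; [BCK21] = arXiv:1908.09512 Thm. 4.1, eq. (A3)–(A4);
Castella, J. London Math. Soc. (2) 96 (2017) App. A; [Howard2004HeegnerKolyvagin] Thm. 2.2.10 / 2.3.1; [Hsieh2014] Thm. B; Hida, Ann. of Math. 172 (2010).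
-/

noncomputable section

open scoped Classical NumberField

set_option linter.dupNamespace false
set_option autoImplicit false

namespace Summit.BirchSwinnertonDyer.BirchSwinnertonDyer.Cruxes.TwinAlgMuZeroAtThree.SelfDualFlach

open NumberField IsDedekindDomain Field WeierstrassCurve
open Literature.NumberTheory.EllipticCurves Literature.NumberTheory.EllipticCurves.IwasawaAlgebra
open Literature.NumberTheory.EllipticCurves.ZpExtension
open Summit.BirchSwinnertonDyer.Rank1Residual.X11b Summit.BirchSwinnertonDyer.Rank1Residual.X11b.AcSelmer
open Summit.BirchSwinnertonDyer.BirchSwinnertonDyer.Theorems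
open Literature.NumberTheory.EllipticCurves.ModularForms (ModularParametrizationData)

/-- **S_B `FlachHowardShapeMultOfParamAtThree`** — bucket B of crux 24737 in HOWARD SHAPE: for every twin `W′/ℚ` multiplicative and très
ramifié at `3` (`3 ∤ v₃(Δ′)`) with `ρ̄₃` onto and conductor `N′`, GIVEN a modular parametrisation datum `Dt′`, every imaginary quadratic `K`
Heegner for `N′` with odd `d_K`, every anticyclotomic `κ` with topological generator `γ`, `𝔭 ∋ 3` of degree one and `𝔭′ ∋ 3`, `𝔭′ ≠ 𝔭`:
`X_(∅,0)(E′/K_∞)` at `𝔭′` is `Λ`-torsion and SOME frame `L ∈ R₀⟦T⟧` with a norm-one coefficient lies in `Ch·R₀⟦T⟧`.  The line intends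
`L = Col_{𝔭′}(loc_{𝔭′} BF^{ac})²` (Beilinson–Flach bottom class; S1–S4 of the card).  UNDECIDED · EQUIV to the B-half of the crux
(receptacle); implied by K1‴ ∧ K2a‴ (`flachShape_of_betaRoad`).  A `Prop` only; nothing is asserted. -/
def FlachHowardShapeMultOfParamAtThree : Prop :=
    ∀ (W' : WeierstrassCurve ℚ) [W'.IsElliptic] [W'.IsGloballyMinimal] (N' : ℕ) [NeZero N']
      (K : Type) [Field K] [NumberField K] (_Dt' : ModularParametrizationData W' N'),
      Rank1Residual.Mult W' 3 → ¬ 3 ∣ padicValInt 3 W'.minimalDiscriminantInt →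
      W'.HasSurjectiveModNGaloisRep 3 → W'.conductorNorm ℤ = N' → IsImaginaryQuadratic K →
      SatisfiesHeegnerHypothesis N' K → Odd (NumberField.discr K) →
      ∀ (κ : ZpExtension K 3), κ.IsAnticyclotomic →
      ∀ (γ : absoluteGaloisGroup K) [Fact (κ.IsTopGenerator γ)]
        (𝔭 : HeightOneSpectrum (𝓞 K)), ((3 : ℕ) : 𝓞 K) ∈ 𝔭.asIdeal →
        𝔭.asIdeal.ramificationIdx (𝓞 ℚ) = 1 → 𝔭.asIdeal.inertiaDeg (𝓞 ℚ) = 1 →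
      ∀ (𝔭' : HeightOneSpectrum (𝓞 K)), ((3 : ℕ) : 𝓞 K) ∈ 𝔭'.asIdeal → 𝔭' ≠ 𝔭 →
      Module.IsTorsion (IwasawaAlgebra 3) (XAc (W'.baseChange K) 3 κ 𝔭' ∅ γ) ∧
        ∃ L : UnrSeries 3,
          Ideal.span {L} ≤ (XAc.charIdeal (W'.baseChange K) 3 κ 𝔭' ∅ γ).map (PowerSeries.map (Halves.toUnr 3)) ∧
            ∃ i : ℕ, ‖((PowerSeries.coeff i L : unrIntegers 3) : ℂ_[3])‖ = 1

/-! ## Evidence for the WEAKER-OR-EQUAL tag: the line of record's bucket-B pair implies S_B -/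

/-- **K1‴ ∧ K2a‴ ⟹ S_B** (so S_B is no stronger than what line `beta-road` v19 already asks for bucket B): the landed bucket-B chain
`twinAlgMuZeroAtThree_mult_of_betaRoadParam` gives a generator `g′` of `Ch·R₀⟦T⟧` with a norm-one coefficient; take `L = g′`.
[cite: Howard2004HeegnerKolyvagin, Thm. 2.3.1 (shape only)] -/
theorem flachShape_of_betaRoad
    (hK1 : UniversalToricDescentBetaRoadParamDefs.PrincipalHeegnerIndivisibleMultOfParamAtThree)
    (hK2 : UniversalToricDescentKsTwinLambdaDefs.KsTwinLambdaAdicAtThree) :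
    FlachHowardShapeMultOfParamAtThree := by
  intro W' _ _ N' _ K _ _ Dt' hm htr hsurj hN hK hH hodd κ hκ γ _ 𝔭 h𝔭 he hf 𝔭' h𝔭' hne
  obtain ⟨htors, g, hg, hμ⟩ :=
    UniversalToricDescentTwinAlgMuZeroAtThreeOfBetaRoadParam.twinAlgMuZeroAtThree_mult_of_betaRoadParam hK1 hK2
      W' N' K Dt' hm htr hsurj hN hK hH hodd κ hκ γ 𝔭 h𝔭 he hf 𝔭' h𝔭' hne
  exact ⟨htors, g, le_of_eq hg.symm, hμ⟩

/-! ## The two stubs of the node (the ONLY `sorry`s of this file) -/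

/-- **stub S_B** (`FlachHowardShapeMultOfParamAtThree`) — UNDECIDED; research; informal children S1 (anticyclotomic Beilinson–Flach system of the
3-new twin inside `Sel_{Gr,Gr}` by sign `−1`), S2 (Howard/CGLS ES→KS for it at `3 ∥ N′`), S3 (`g`-dominant reciprocity law at the 3-new point),
S4 ((A3) bookkeeping) — see `Lines/self_dual_flach.md`.  [cite: KLZ17 Thm. 6.3.4; BCK21 eq. (A3); Howard2004HeegnerKolyvagin Thm. 2.2.10] -/
theorem stub_flachMult : FlachHowardShapeMultOfParamAtThree := by
  sorry

/-- **stub C₀′** — the registered good-supersingular constant of line `beta-road` v19 BY NAME (untouched by this line). -/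
theorem stub_goodSS : UniversalToricDescentBetaRoadParamDefs.TwinAlgMuZeroAtThreeGoodSSOfParam := by
  sorry

/-! ## Composition: the crux BY NAME -/

/-- **Crux 24737 `TwinAlgMuZeroAtThree` BY NAME from S_B and C₀′**: split the bucket disjunction; on B apply S_B and the route's receptacle
`UniversalToricDescentTwinAlgMu.xac_exists_generator_norm_one_of_span_le` (a frame with a norm-one coefficient inside `Ch·R₀⟦T⟧` yields a
generator with one); on C₀ apply C₀′.  Kernel-checked; no `sorry`. [cite: Washington1997, §13.2 (principal characteristic ideals)] -/
theorem TwinAlgMuZeroAtThree_of (hB : FlachHowardShapeMultOfParamAtThree)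
    (hC0 : UniversalToricDescentBetaRoadParamDefs.TwinAlgMuZeroAtThreeGoodSSOfParam) :
    Summit.BirchSwinnertonDyer.BirchSwinnertonDyer.Theses.UniversalToricDescent.TwinAlgMuZeroAtThree := by
  intro W' _ _ N' _ K _ _ Dt' hbucket hsurj hN hK hH hodd κ hκ γ _ 𝔭 h𝔭 he hf 𝔭' h𝔭' hne
  rcases hbucket with ⟨hm, htr⟩ | ⟨hss, ha⟩
  · obtain ⟨htors, L, hle, hL⟩ := hB W' N' K Dt' hm htr hsurj hN hK hH hodd κ hκ γ 𝔭 h𝔭 he hf 𝔭' h𝔭' hne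
    exact ⟨htors, UniversalToricDescentTwinAlgMu.xac_exists_generator_norm_one_of_span_le (W'.baseChange K) κ 𝔭' ∅ γ hle hL⟩
  · exact (UniversalToricDescentBetaRoadParamDefs.twinAlgMuZeroAtThreeGoodSSOfParam_iff.mp hC0)
      W' N' K Dt' hss ha hsurj hN hK hH hodd κ hκ γ 𝔭 h𝔭 he hf 𝔭' h𝔭' hne

/-- **The node closes the crux from its two stubs** (= `TwinAlgMuZeroAtThree_of stub_flachMult stub_goodSS`; inherits their `sorry`s). -/
theorem TwinAlgMuZeroAtThree_of_stubs :
    Summit.BirchSwinnertonDyer.BirchSwinnertonDyer.Theses.UniversalToricDescent.TwinAlgMuZeroAtThree :=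
  TwinAlgMuZeroAtThree_of stub_flachMult stub_goodSS

/-- **And the line of record feeds this node**: K1‴ ∧ K2a‴ ∧ C₀′ ⟹ crux through S_B (sanity: the node is a re-cut, not a strengthening). -/
theorem TwinAlgMuZeroAtThree_of_betaRoad_via_flachShape
    (hK1 : UniversalToricDescentBetaRoadParamDefs.PrincipalHeegnerIndivisibleMultOfParamAtThree)
    (hK2 : UniversalToricDescentKsTwinLambdaDefs.KsTwinLambdaAdicAtThree)
    (hC0 : UniversalToricDescentBetaRoadParamDefs.TwinAlgMuZeroAtThreeGoodSSOfParam) :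
    Summit.BirchSwinnertonDyer.BirchSwinnertonDyer.Theses.UniversalToricDescent.TwinAlgMuZeroAtThree :=
  TwinAlgMuZeroAtThree_of (flachShape_of_betaRoad hK1 hK2) hC0

end Summit.BirchSwinnertonDyer.BirchSwinnertonDyer.Cruxes.TwinAlgMuZeroAtThree.SelfDualFlach

end
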